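import Summits.RiemannHypothesis.RiemannHypothesis.Theorems.WindowTraceArch.Negative.LocalWeyl
import Summits.RiemannHypothesis.RiemannHypothesis.Theorems.SpectralTraceWindowTraceArchStubBase
import Summits.RiemannHypothesis.RiemannHypothesis.Theorems.SpectralTraceWindowTraceArchStubDisplacementBoundAux
import Summits.RiemannHypothesis.RiemannHypothesis.Theorems.SpectralTraceWindowTraceArchStubDisplacementBound
import Literature.NumberTheory.LFunctions.WeilWindowSimpleEven
import HarnessLib

/-!
# RiemannHypothesis / SpectralTrace — crux `WindowTraceArch`, line `defect-compactness-design`: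
# the structure assembly, part 1 (reflection, infinitude, the sorted positive lattice)

Route `RiemannHypothesis/SpectralTrace`, crux item stmt-RiemannHypothesis-11195 (`WindowTraceArch`),
line `defect-compactness-design`, wave 2 ("structure of witnesses"), stub `stub_structureAssembly`
(helper file 1 of 2, `--supports`, landing anchor = the registered sub-goal stub
`stub_structureAssembly_lattice`; held by the line lead). Part 2 (`…StubStructureAssembly.lean`)
imports this file and proves `stub_structureAssembly` itself.

**Statement.** Given (as hypotheses, proved in the sibling files of this wave) the two-sided
COUNTING LAW of witnesses (`stub_countingLaw`: `#{i : γ i ∈ [0,T]} = θ(T)/π + O(log(1+T))`), the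
SORTED ENUMERATION of locally finite families (`stub_sortedEnumeration`) and the passage FROM
COUNTING TO DISPLACEMENT (`stub_displacementBound`): if `γ : ι → ℝ` is a witness of the crux (it
reproduces the Weil functional on every Weil test supported in `[-log 2, log 2]`), then for every
injective enumeration `x` of the symmetric França–LeClair lattice
`FL = {t : 7 ≤ |t| ∧ cos θ(t) = 0}` there are `D` and `δ : ℕ → ℝ` with `|δ n| ≤ D` such that
`n ↦ x n + δ n` is a RE-INDEXING of `γ` — hence again a witness.

**Proof.** (1) The reflected family `-γ` is also a witness (`weilMellin_comp_neg`,
`weilFunctional_comp_neg`: Weil's distribution and the window are even). (2) Local finiteness of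
witnesses (`finite_abs_le_of_windowTraceArch_witness`) and the counting law (with `θ(T) ≥ T/2 − 2`,
`log ≤ 2√·`) make both index sets `{γ ≥ 0}` and `{γ < 0}` infinite; sort them
(`stub_sortedEnumeration`, the negative one through the subtype `{i // γ i < 0}`). (3) The positive
lattice points in increasing order are `p n`, `θ(p n) = (n − ½)π`, `p n ≥ 7` (IVT from
`θ(7) ∈ (−3π/2, −π/2)`; `FL = {p n} ⊔ {−p n}` since `cos θ t = 0 ↔ θ t ∈ π/2 + πℤ` and `θ` is odd and
strictly increasing on `[7,∞)`). (4) `stub_displacementBound` gives `|γ(ep n) − p n| ≤ Dp` and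
`|γ(em n) + p n| ≤ Dm` (the counting law of `−γ` on `{γ < 0}` loses only the finitely many zeros).
(5) Transport along the bijection `ℕ ≃ ι` obtained by composing `x : ℕ ≃ FL`, `FL ≃ ℕ ⊕ ℕ` and
`ep ⊕ em : ℕ ⊕ ℕ ≃ ι` (`Equiv.hasSum_iff`).

Imports only landed tree modules; no named fact is used; no definitions.
-/

set_option linter.dupNamespace false

noncomputable section

open Complex Filter Set MeasureTheory
open scoped Real Topology

namespace Summit.RiemannHypothesis.RiemannHypothesis.Theorems.SpectralTraceWindowTraceArch

open Literature.NumberTheory.LFunctions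
open Literature.Barriers.RiemannHypothesis
open Summit.RiemannHypothesis.RiemannHypothesis.Theorems.WindowTraceArch.Negative

/-! ## (1) The reflected family is a witness -/

/-- **Reflection of a witness.** If `γ` reproduces `W` on the window tests then so does `−γ`:
test `g(−·)` (again a window Weil test), `(g(−·))^(½+iγ) = ĝ(½−iγ)` (`weilMellin_comp_neg`) and
`W(g(−·)) = W(g)` (`weilFunctional_comp_neg`). [folklore] -/
theorem stub_structureAssembly_reflect {ι : Type} {γ : ι → ℝ}
    (h : ∀ g : ℝ → ℂ, IsWeilTest g → tsupport g ⊆ Icc (-Real.log 2) (Real.log 2) →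
      HasSum (fun i => weilMellin g (1 / 2 + (γ i : ℂ) * I)) (weilFunctional g)) :
    ∀ g : ℝ → ℂ, IsWeilTest g → tsupport g ⊆ Icc (-Real.log 2) (Real.log 2) →
      HasSum (fun i => weilMellin g (1 / 2 + ((-γ i : ℝ) : ℂ) * I)) (weilFunctional g) := by
  intro g hg hgs
  set g' : ℝ → ℂ := fun t => g (-t) with hg'
  have hg'test : IsWeilTest g' :=
    ⟨hg.1.comp contDiff_neg, by
      simpa [hg', Function.comp_def] using hg.2.comp_homeomorph (Homeomorph.neg ℝ)⟩
  have hg'supp : tsupport g' ⊆ Icc (-Real.log 2) (Real.log 2) := by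
    have e : g' = g ∘ (Homeomorph.neg ℝ) := by funext t; simp [hg']
    rw [e, tsupport_comp_eq_preimage]
    intro t ht
    have ht' : -t ∈ Icc (-Real.log 2) (Real.log 2) := hgs ht
    simp only [mem_Icc] at ht' ⊢
    constructor <;> linarith [ht'.1, ht'.2]
  have hsum := h g' hg'test hg'supp
  rw [show weilFunctional g' = weilFunctional g from weilFunctional_comp_neg g] at hsum
  refine hsum.congr_fun fun i => ?_
  show weilMellin g _ = weilMellin (fun t => g (-t)) _
  rw [weilMellin_comp_neg]
  congr 1
  push_cast
  ring

/-! ## (2) Witnesses have infinitely many points on each side -/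

/-- From the counting law: the non-negative index set of a family obeying
`#{i : γ i ∈ [0,T]} ≥ θ(T)/π − C(1+log(1+T))` is infinite. [folklore] -/
theorem stub_structureAssembly_infinite {ι : Type} {γ : ι → ℝ} {C : ℝ}
    (hcl : ∀ T : ℝ, 0 ≤ T → {i : ι | γ i ∈ Icc 0 T}.Finite ∧
      |(({i : ι | γ i ∈ Icc 0 T}.ncard : ℕ) : ℝ) - riemannSiegelTheta T / π| ≤ C * (1 + Real.log (1 + T))) :
    {i : ι | 0 ≤ γ i}.Infinite := by
  intro hfin
  have hπ0 : 0 < π := Real.pi_pos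
  have hπ3 : π < 3.15 := Real.pi_lt_d2
  -- the count is bounded by `N`
  set N : ℕ := hfin.toFinset.card with hN
  have hC0 : 0 ≤ C := by
    have h0 := (hcl 0 le_rfl).2
    have : (0 : ℝ) ≤ C * (1 + Real.log (1 + 0)) := le_trans (abs_nonneg _) h0
    simpa using this
  -- choose `T` large
  set M : ℝ := 8 * (C + 1) with hM
  have hM0 : 0 ≤ M := by rw [hM]; positivity
  set T : ℝ := max 100 (max (16 * M ^ 2) (16 * ((N : ℝ) + C + 1))) with hT
  have hT100 : (100 : ℝ) ≤ T := le_max_left _ _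
  have hT16 : 16 * M ^ 2 ≤ 1 + T := by
    have : 16 * M ^ 2 ≤ T := (le_max_left _ _).trans (le_max_right _ _)
    linarith
  have hT8 : 16 * ((N : ℝ) + C + 1) ≤ T := (le_max_right _ _).trans (le_max_right _ _)
  have hT0 : 0 ≤ T := by linarith
  obtain ⟨hSfin, hS⟩ := hcl T hT0
  -- `#S ≤ N`
  have hsub : {i : ι | γ i ∈ Icc 0 T} ⊆ {i : ι | 0 ≤ γ i} := fun i hi => hi.1
  have hcard : ({i : ι | γ i ∈ Icc 0 T}.ncard : ℝ) ≤ N := by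
    have h1 : {i : ι | γ i ∈ Icc 0 T}.ncard ≤ {i : ι | 0 ≤ γ i}.ncard := Set.ncard_le_ncard hsub hfin
    rw [Set.ncard_eq_toFinset_card _ hfin] at h1
    exact_mod_cast h1
  -- lower bound from the counting law
  have hlow : riemannSiegelTheta T / π - C * (1 + Real.log (1 + T)) ≤
      ({i : ι | γ i ∈ Icc 0 T}.ncard : ℝ) := by
    have := (abs_le.1 hS).1
    linarith
  -- `θ(T) ≥ T/2 - 2`, `C log(1+T) ≤ (1+T)/2 · (C/M)`-type bound
  have hθ := stub_displacementBound_theta_ge hT100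
  have hlog : M * Real.log (1 + T) ≤ (1 + T) / 2 :=
    stub_displacementBound_log_le_half hM0 (by linarith) hT16
  have hlog0 : 0 ≤ Real.log (1 + T) := Real.log_nonneg (by linarith)
  have hClog : C * (1 + Real.log (1 + T)) ≤ C + (1 + T) / 16 := by
    have h1 : C * Real.log (1 + T) ≤ (1 + T) / 16 := by
      have h2 : 8 * (C + 1) * Real.log (1 + T) ≤ (1 + T) / 2 := by rw [hM] at hlog; exact hlog
      nlinarith
    linarith
  have hdiv : (T / 2 - 2) / π ≤ riemannSiegelTheta T / π := div_le_div_of_nonneg_right hθ hπ0.le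
  have hdiv' : (T / 2 - 2) / 4 ≤ (T / 2 - 2) / π :=
    div_le_div_of_nonneg_left (by linarith) hπ0 (by linarith)
  have : (T / 2 - 2) / 4 - (C + (1 + T) / 16) ≤ (N : ℝ) := by linarith
  linarith

/-! ## (3) The positive França–LeClair points in increasing order -/

/-- `θ(7) ∈ (−3π/2, −π/2)`: numerically `θ(7) = −3.5…`; from Stirling at `t = 7` for the lower
bound and `θ(7) < θ(10) < −2` for the upper one. [folklore] -/
theorem stub_structureAssembly_theta_seven :
    -(3 * π / 2) < riemannSiegelTheta 7 ∧ riemannSiegelTheta 7 < -(π / 2) := by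
  have hπ0 : 3 < π := Real.pi_gt_three
  have hπ3 : π < 3.15 := Real.pi_lt_d2
  constructor
  · have h := (abs_le.1 (abs_riemannSiegelTheta_sub_stirling_le (t := 7) (by norm_num))).1
    have hK := stub_displacementBound_two_stirling_le
    have hK0 : 0 ≤ 2 * stirlingVertRate (1 / 4) := by
      have : (0 : ℝ) ≤ stirlingVertRate (1 / 4) := by
        rw [stirlingVertRate]; positivity
      linarith
    have hlog : 0 ≤ Real.log (7 / (2 * π)) := Real.log_nonneg (by
      rw [le_div_iff₀ (by positivity)]; linarith)
    have h7 : (7 : ℝ) / 2 * Real.log (7 / (2 * π)) ≥ 0 := by positivity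
    have hdiv : 2 * stirlingVertRate (1 / 4) / 7 ≤ 6 / 5 / 7 := by
      apply div_le_div_of_nonneg_right hK (by norm_num)
    nlinarith
  · have hmono := strictMonoOn_riemannSiegelTheta_Ici_seven (a := 7) (b := 10)
      (by simp) (by norm_num) (by norm_num)
    have h10 := riemannSiegelTheta_ten_lt
    linarith

/-- The positive lattice: there is `p : ℕ → ℝ`, strictly increasing, `p n ≥ 7`,
`θ(p n) = (n − ½)π`, whose values together with their negatives are exactly
`FL = {t : 7 ≤ |t| ∧ cos θ t = 0}`, the two halves being disjoint. [folklore] -/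
theorem stub_structureAssembly_lattice :
    ∃ p : ℕ → ℝ, StrictMono p ∧ (∀ n, 7 ≤ p n) ∧ (∀ n : ℕ, Literature.NumberTheory.LFunctions.riemannSiegelTheta (p n) = ((n : ℝ) - 1 / 2) * Real.pi) ∧ (∀ t : ℝ, (7 ≤ |t| ∧ Real.cos (Literature.NumberTheory.LFunctions.riemannSiegelTheta t) = 0) ↔ ∃ n, t = p n ∨ t = -p n) ∧ (∀ n m : ℕ, p n ≠ -p m) := by
  have hπ0 : 0 < π := Real.pi_pos
  obtain ⟨hθ7l, hθ7u⟩ := stub_structureAssembly_theta_seven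
  -- existence of each level
  have hex : ∀ n : ℕ, ∃ t : ℝ, 7 ≤ t ∧ riemannSiegelTheta t = ((n : ℝ) - 1 / 2) * π := by
    intro n
    refine stub_base_exists_eq ?_
    have hn : (0 : ℝ) ≤ n := n.cast_nonneg
    nlinarith
  choose p hp7 hpθ using hex
  have hmono : StrictMono p := by
    refine strictMono_nat_of_lt_succ fun n => ?_
    have hlt : riemannSiegelTheta (p n) < riemannSiegelTheta (p (n + 1)) := by
      rw [hpθ, hpθ]; push_cast; nlinarith
    exact (strictMonoOn_riemannSiegelTheta_Ici_seven.lt_iff_lt (hp7 n) (hp7 (n + 1))).1 hlt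
  refine ⟨p, hmono, hp7, hpθ, fun t => ⟨fun ⟨ht7, hcos⟩ => ?_, ?_⟩, fun n m h => ?_⟩
  · -- `t ∈ FL ⇒ t = ± p n`
    -- reduce to `u = |t| ≥ 7` with `cos θ u = 0`
    have key : ∀ u : ℝ, 7 ≤ u → Real.cos (riemannSiegelTheta u) = 0 → ∃ n, u = p n := by
      intro u hu hcu
      obtain ⟨k, hk⟩ := Real.cos_eq_zero_iff.1 hcu
      -- `θ u ≥ θ 7 > -3π/2` forces `k ≥ -1`
      have hθu : riemannSiegelTheta 7 ≤ riemannSiegelTheta u :=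
        stub_base_monotoneOn (by simp) (show u ∈ Ici (7:ℝ) from hu) hu
      have hk1 : (-2 : ℤ) < k := by
        by_contra hle
        push Not at hle
        have hle' : (k : ℝ) ≤ -2 := by exact_mod_cast hle
        have : riemannSiegelTheta u ≤ -(3 * π / 2) := by rw [hk]; nlinarith
        linarith
      -- `n := k + 1 ≥ 0`
      obtain ⟨n, hn⟩ : ∃ n : ℕ, (n : ℤ) = k + 1 := ⟨(k + 1).toNat, by omega⟩
      refine ⟨n, ?_⟩
      have hθn : riemannSiegelTheta u = ((n : ℝ) - 1 / 2) * π := by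
        have hn' : (n : ℝ) = (k : ℝ) + 1 := by exact_mod_cast hn
        rw [hk, hn']; ring
      have := strictMonoOn_riemannSiegelTheta_Ici_seven.injOn (show u ∈ Ici (7:ℝ) from hu)
        (show p n ∈ Ici (7:ℝ) from hp7 n) (hθn.trans (hpθ n).symm)
      exact this
    rcases le_abs'.1 ht7 with hneg | hpos
    · -- `t ≤ -7`
      have hu : 7 ≤ -t := by linarith
      obtain ⟨n, hn⟩ := key (-t) hu (by rw [stub_base_cos_neg]; exact hcos)
      exact ⟨n, Or.inr (by linarith)⟩
    · obtain ⟨n, hn⟩ := key t hpos hcos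
      exact ⟨n, Or.inl hn⟩
  · rintro ⟨n, rfl | rfl⟩
    · refine ⟨by rw [abs_of_nonneg (by linarith [hp7 n])]; exact hp7 n, ?_⟩
      rw [hpθ, Real.cos_eq_zero_iff]
      exact ⟨(n : ℤ) - 1, by push_cast; ring⟩
    · refine ⟨by rw [abs_neg, abs_of_nonneg (by linarith [hp7 n])]; exact hp7 n, ?_⟩
      rw [stub_base_cos_neg, hpθ, Real.cos_eq_zero_iff]
      exact ⟨(n : ℤ) - 1, by push_cast; ring⟩
  · have := hp7 n; have := hp7 m; linarith

end Summit.RiemannHypothesis.RiemannHypothesis.Theorems.SpectralTraceWindowTraceArch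

end
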